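import Summits.CriticalPhenomena.PercolationContinuityZ3.Theorems.PercNearOneGluingNoHeavyQuantChemicalRadiusSteepness
import Literature.Probability.Percolation.GapExponentTriangle
import Literature.Probability.Percolation.InfraredBoundTriangle
import Literature.Barriers.CriticalPhenomena.LaceExpansionHighDimensionTriangleHolds
import HarnessLib

/-!
# THE INTRINSIC BALL: `P_q(d_ω(0,z) ≤ r) ≤ (q/p)^r P_p(d_ω(0,z) ≤ r)`, SAPOZHNIKOV'S BOUND
# `E_{p_c}|B_int(0,r)| ≤ (p_c/p)^r χ(p)` (`p < p_c`, every `d ≥ 2`), HENCE `E_{p_c}|B_int(0,r)| ≤ C r^γ` AND, UNDER THE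
# TRIANGLE CONDITION / IN HIGH DIMENSIONS, `E_{p_c}|B_int(0,r)| ≤ C r` (Kozma–Nachmias 2009 Thm 1.2(i), upper half)
# — quant lane, seat p4 gen 38, file 4

builds on p205010 (kernel theorem, internal audit signed; external expert review pending) — NOT used in this file.
Seat `prim-quant-p4`, `--supports stmt-CriticalPhenomena-4575`; pure proofs, no definitions (`local notation3` only).

`B_int(0,r) = Chemical.ball (zdGraph d) 0 r ω` is the intrinsic (chemical) ball of the open cluster of the origin;
`S_p(r) = Σ_{z ∈ Λ_r} P_p(z ∈ B_int(0,r))` is its expected volume (`B_int(0,r) ⊆ Λ_r`, `ChemRad.ball_subset_box`).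
For each `z` the event `{z ∈ B_int(0,r)} = {d_ω(0,z) ≤ r}` is increasing, is read off the edges of `Λ_r`
(`ChemRad.mem_ball_zd_iff_mem_ball_box`), and an open edge whose closing destroys it lies on any open path of length `≤ r`
from `0` to `z` — so file 1's closing-pivotal steepness applies with NO limiting procedure:

* §1 `ChemRad.exists_walk_closePivotal_ball`, `ChemRad.determinedBy_mem_ball`, **`ChemRad.real_ball_le_pow_mul_real_ball`**:
  `P_q(z ∈ B_int(0,r)) ≤ (q/p)^r P_p(z ∈ B_int(0,r))` on `ℤ^d` (`0 < p ≤ q < 1`; this is the coupling inequality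
  `P_p(d(0,x) ≤ n) ≥ (p/p_c)^n P_{p_c}(d(0,x) ≤ n)` of Sapozhnikov's proof of HvdH Lemma 11.6, obtained here from Russo).
* §2 **`ChemRad.sumBall_le_pow_mul_sumBall`** (`S_q(r) ≤ (q/p)^r S_p(r)`), `ChemRad.sumBall_le_chi` (`S_p(r) ≤ χ(p)`, `p < p_c`),
  **`ChemRad.sumBall_criticalProbI_le`** — SAPOZHNIKOV: `S_{p_c}(r) ≤ (p_c/p)^r χ(p)` for every `0 < p < p_c`, every `d ≥ 2`.
* §3 **`ChemRad.sumBall_criticalProbI_le_rpow_of_chi_le`** — DICTIONARY (every `d ≥ 2`): `χ(p) ≤ A (p_c − p)^{−γ}` below `p_c`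
  ⟹ `E_{p_c}|B_int(0,r)| ≤ 2A(2/p_c)^γ · r^γ` (`p = p_c(1 − 1/(2r))`, `(1 − 1/(2r))^{−r} ≤ 2`): the intrinsic volume growth
  exponent at criticality is at most `γ`; **`ChemRad.sumBall_criticalProbI_le_linear_of_triangle`**, **`…_high_dim`** —
  `TriangleCondition d` (tree theorem for `d ≥ D`) ⟹ `E_{p_c}|B_int(0,r)| ≤ C r` (`γ = 1`, tree `chi_le_div_of_triangle`):
  Kozma–Nachmias 2009 Thm 1.2(i) / HvdH Lemma 11.6, upper half, in the kernel.

HONEST STATUS.  §1 is new as typed only in its derivation (Russo-type steepness instead of the `p/p_c`-thinning coupling); §2–§3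
REPRODUCE Sapozhnikov's argument (HvdH 2017 Lemma 11.6, proof of the upper bound) with explicit constants; the lower half
`E_{p_c}|B_int(0,r)| ≥ c r` (Kozma–Nachmias, needs the two-point function) is NOT treated.  NO rate, NO exponent for `d = 3`;
(T1)/(T2) and the lane's honest sentence UNCHANGED.

References: M. Heydenreich, R. van der Hofstad (2017) Lemma 11.6 (11.3.4) and its proof [HeydenreichVanDerHofstad2017];
G. Kozma, A. Nachmias, Invent. Math. 178 (2009) Thm 1.2(i) [KozmaNachmias2009]; A. Sapozhnikov, arXiv:1006.1521
(cited via HvdH); T. Hutchcroft, PLMS 125 (2022) Lemma 2.1 [Hutchcroft2022SlightlySupercritical].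
-/

noncomputable section

namespace Summit.CriticalPhenomena.PercolationContinuityZ3.Theorems

open MeasureTheory Set Filter Topology Literature.Probability.Percolation Literature.Probability.LatticeModels
open Literature.Probability.Percolation.Chemical
open scoped Classical

namespace ChemRad

variable {V : Type*}

/-! ### §1. The increasing events `{z ∈ B_int(v, r)}`: closing-pivotal edges on one open path of length `≤ r` -/

/-- If `z ∈ B(v, r; K)(ω)`, the open edges whose closing removes `z` from the ball all lie on one open `K`-walk of length
`≤ r` from `v` to `z` (an edge off that walk leaves it open). [cite: Hutchcroft2022SlightlySupercritical, Lemma 2.1 (proof, ball version)] -/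
theorem exists_walk_closePivotal_ball (K : SimpleGraph V) (v z : V) (r : ℕ) {ω : BondConfig V}
    (hω : z ∈ ball K v r ω) :
    ∃ T : Finset (Sym2 V), T.card ≤ r ∧ ∀ e : Sym2 V, e ∈ ω → z ∉ ball K v r (ω \ {e}) → e ∈ T := by
  obtain ⟨w, hw⟩ := hω
  refine ⟨w.edges.toFinset, ?_, fun e _ hnot => ?_⟩
  · refine le_trans (List.toFinset_card_le w.edges) ?_
    rw [SimpleGraph.Walk.length_edges]; exact hw
  · by_contra heT
    rw [List.mem_toFinset] at heT
    have hedges : ∀ e' ∈ w.edges, e' ∈ (openGraph (ω \ {e}) ⊓ K).edgeSet := by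
      intro e' he'
      have hne : e' ≠ e := fun h => heT (h ▸ he')
      induction e' using Sym2.ind with
      | h a b =>
        have hab := w.adj_of_mem_edges he'
        rw [SimpleGraph.inf_adj, openGraph_adj] at hab
        rw [SimpleGraph.mem_edgeSet, SimpleGraph.inf_adj, openGraph_adj]
        exact ⟨⟨⟨hab.1.1, hne⟩, hab.1.2⟩, hab.2⟩
    exact hnot ⟨w.transfer _ hedges, by rw [SimpleGraph.Walk.length_transfer]; exact hw⟩

/-- The ball only reads the edges of `K`: `B(v, i; K)(ω ∩ E(K)) = B(v, i; K)(ω)`. [folklore] -/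
theorem ball_inter_edgeSet (K : SimpleGraph V) (v : V) (i : ℕ) (ω : BondConfig V) :
    ball K v i (ω ∩ K.edgeSet) = ball K v i ω := by
  have h : openGraph (ω ∩ K.edgeSet) ⊓ K = openGraph ω ⊓ K := by
    rw [openGraph_inter_edgeSet, inf_assoc, inf_idem]
  ext z
  simp only [ball, Set.mem_setOf_eq]
  rw [h]

/-- **`{z ∈ B(v, r; K)}` is determined by the edges of `K`.** [folklore] -/
theorem determinedBy_mem_ball (K : SimpleGraph V) (v z : V) (r : ℕ) :
    DeterminedBy {ω : BondConfig V | z ∈ ball K v r ω} K.edgeSet := by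
  rw [determinedBy_iff]
  intro ω ω' h
  simp only [Set.mem_setOf_eq]
  rw [← ball_inter_edgeSet K v r ω, ← ball_inter_edgeSet K v r ω', h]

/-- **`P_q(z ∈ B(v,r;K)) ≤ (q/p)^r · P_p(z ∈ B(v,r;K))`** (`0 < p ≤ q < 1`) for every step graph `K ≤ G` with finitely many
edges. [cite: Hutchcroft2022SlightlySupercritical, Lemma 2.1 (proof, ball version)] -/
theorem real_ball_le_pow_mul_real_ball_fin (G K : SimpleGraph V) (hKG : K ≤ G) (hfin : K.edgeSet.Finite) (v z : V) (r : ℕ)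
    (p q : unitInterval) (hp0 : 0 < (p : ℝ)) (hpq : (p : ℝ) ≤ q) (hq1 : (q : ℝ) < 1) :
    (bondPercolation G q).real {ω | z ∈ ball K v r ω} ≤
      ((q : ℝ) / p) ^ r * (bondPercolation G p).real {ω | z ∈ ball K v r ω} := by
  have hF : (↑hfin.toFinset : Set (Sym2 V)) ⊆ G.edgeSet := by
    rw [Set.Finite.coe_toFinset]; exact SimpleGraph.edgeSet_subset_edgeSet.2 hKG
  have hB : DeterminedBy {ω : BondConfig V | z ∈ ball K v r ω} (↑hfin.toFinset : Set (Sym2 V)) := by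
    rw [Set.Finite.coe_toFinset]; exact determinedBy_mem_ball K v z r
  exact real_le_pow_mul_real G hF hB (fun ω hω => by
    obtain ⟨T, hT, h⟩ := exists_walk_closePivotal_ball K v z r hω
    exact ⟨T, hT, fun e _ he hne => h e he hne⟩) p q hp0 hpq hq1

variable {d : ℕ}

/-- `K_N`: the step graph of `ℤ^d` whose edges are the lattice edges with both endpoints in `Λ_N` (as in file 2). -/
local notation3 "KB[" N "]" =>
  SimpleGraph.fromEdgeSet (↑(edgesIn (zdGraph d) (box d N)) : Set (Sym2 (Site d)))

/-- **Locality of the intrinsic ball on `ℤ^d`**: `z ∈ B_int(0, r)(ω)` in `ℤ^d` iff `z ∈ B(0, r; K_r)(ω)` — an open path of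
length `≤ r` from the origin stays in `Λ_r`. [folklore] -/
theorem mem_ball_zd_iff_mem_ball_box (z : Site d) (r : ℕ) (ω : BondConfig (Site d)) :
    z ∈ ball (zdGraph d) 0 r ω ↔ z ∈ ball (KB[r] : SimpleGraph (Site d)) 0 r ω := by
  constructor
  · rintro ⟨w, hw⟩
    exact ⟨w.transfer _ (edges_mem_boxGraph w hw), by rw [SimpleGraph.Walk.length_transfer]; exact hw⟩
  · rintro ⟨w, hw⟩
    exact ⟨w.mapLe (inf_le_inf_left _ (boxGraph_le r)), (SimpleGraph.Walk.length_map _ _).trans_le hw⟩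

/-- The intrinsic ball of radius `r` lies in the box `Λ_r`. [folklore] -/
theorem ball_subset_box (r : ℕ) (ω : BondConfig (Site d)) : ball (zdGraph d) 0 r ω ⊆ ↑(box d r) := by
  rintro z ⟨w, hw⟩
  have h := mem_box_of_mem_support (w.map (SimpleGraph.Hom.ofLE inf_le_right)) (zero_mem_box d 0) z
    (SimpleGraph.Walk.end_mem_support _)
  rw [SimpleGraph.Walk.length_map, zero_add] at h
  exact box_mono d hw h

/-- **`P_q(z ∈ B_int(0,r)) ≤ (q/p)^r · P_p(z ∈ B_int(0,r))` on `ℤ^d`** for `0 < p ≤ q < 1`, every `z`, `r`, `d`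
(the coupling inequality of Sapozhnikov's proof of HvdH Lemma 11.6, `P_p(d(0,x) ≤ n) ≥ (p/p_c)^n P_{p_c}(d(0,x) ≤ n)`, in both
directions of use). [cite: HeydenreichVanDerHofstad2017, Lemma 11.6 (proof, first display)] -/
theorem real_ball_le_pow_mul_real_ball (z : Site d) (r : ℕ) (p q : unitInterval) (hp0 : 0 < (p : ℝ))
    (hpq : (p : ℝ) ≤ q) (hq1 : (q : ℝ) < 1) :
    (bondPercolation (zdGraph d) q).real {ω | z ∈ ball (zdGraph d) 0 r ω} ≤
      ((q : ℝ) / p) ^ r * (bondPercolation (zdGraph d) p).real {ω | z ∈ ball (zdGraph d) 0 r ω} := by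
  have hset : {ω : BondConfig (Site d) | z ∈ ball (zdGraph d) 0 r ω} =
      {ω | z ∈ ball (KB[r] : SimpleGraph (Site d)) 0 r ω} :=
    Set.ext fun ω => mem_ball_zd_iff_mem_ball_box z r ω
  rw [hset]
  exact real_ball_le_pow_mul_real_ball_fin (zdGraph d) _ (boxGraph_le r) (boxGraph_edgeSet_finite r) 0 z r p q hp0 hpq hq1

/-! ### §2. The expected intrinsic volume `S_p(r) = Σ_{z ∈ Λ_r} P_p(z ∈ B_int(0,r))` and Sapozhnikov's bound -/

/-- `S_p(r) = Σ_{z ∈ Λ_r} P_p(z ∈ B_int(0,r)) = E_p|B_int(0,r)|` (the ball lies in `Λ_r`). -/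
local notation3 "SB[" p ", " r "]" =>
  ∑ z ∈ box d r, (bondPercolation (zdGraph d) p).real {ω : BondConfig (Site d) | z ∈ ball (zdGraph d) 0 r ω}

/-- **`S_q(r) ≤ (q/p)^r · S_p(r)`** for `0 < p ≤ q < 1` (sum §1 over `z ∈ Λ_r`).
[cite: HeydenreichVanDerHofstad2017, Lemma 11.6 (proof)] -/
theorem sumBall_le_pow_mul_sumBall (r : ℕ) (p q : unitInterval) (hp0 : 0 < (p : ℝ)) (hpq : (p : ℝ) ≤ q)
    (hq1 : (q : ℝ) < 1) : SB[q, r] ≤ ((q : ℝ) / p) ^ r * SB[p, r] := by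
  rw [Finset.mul_sum]
  exact Finset.sum_le_sum fun z _ => real_ball_le_pow_mul_real_ball z r p q hp0 hpq hq1

/-- **`S_p(r) ≤ χ(p)` below `p_c`** (`d ≥ 2`): `P_p(z ∈ B_int(0,r)) ≤ τ_p(0,z)` and `Σ_{z∈Λ_r} τ_p(0,z) ≤ Σ_z τ_p(0,z) = χ(p)`.
[cite: HeydenreichVanDerHofstad2017, Lemma 11.6 (proof: P(d(0,x) ≤ n) ≤ P(0 ↔ x))] -/
theorem sumBall_le_chi (hd : 2 ≤ d) (r : ℕ) (p : unitInterval) (hp : (p : ℝ) < criticalProb (zdGraph d) (0 : Site d)) :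
    SB[p, r] ≤ chi d p := by
  calc SB[p, r] ≤ ∑ z ∈ box d r, tau d p 0 z := by
        refine Finset.sum_le_sum fun z _ => ?_
        rw [tau_def]
        refine measureReal_mono (fun ω hω => ?_) (measure_ne_top _ _)
        obtain ⟨w, -⟩ := (hω : z ∈ ball (zdGraph d) 0 r ω)
        exact ⟨w.map (SimpleGraph.Hom.ofLE inf_le_left)⟩
    _ ≤ chi d p := Summable.sum_le_tsum _ (fun z _ => tau_nonneg p 0 z) (summable_tau_of_lt_criticalProb hd p hp)

/-- **SAPOZHNIKOV'S BOUND, every `d ≥ 2`: `E_{p_c}|B_int(0,r)| = S_{p_c}(r) ≤ (p_c/p)^r · χ(p)` for every `0 < p < p_c`** and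
every `r`. [cite: HeydenreichVanDerHofstad2017, Lemma 11.6 (proof, second display)] -/
theorem sumBall_criticalProbI_le (hd : 2 ≤ d) (r : ℕ) (p : unitInterval) (hp0 : 0 < (p : ℝ))
    (hp : (p : ℝ) < criticalProb (zdGraph d) (0 : Site d)) :
    SB[criticalProbI d, r] ≤ ((criticalProbI d : ℝ) / p) ^ r * chi d p := by
  have hpc1 : (criticalProbI d : ℝ) < 1 := by rw [coe_criticalProbI]; exact criticalProb_zd_lt_one hd
  have hpq : (p : ℝ) ≤ criticalProbI d := by rw [coe_criticalProbI]; exact hp.le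
  refine (sumBall_le_pow_mul_sumBall r p (criticalProbI d) hp0 hpq hpc1).trans ?_
  exact mul_le_mul_of_nonneg_left (sumBall_le_chi hd r p hp) (pow_nonneg (div_nonneg (hp0.le.trans hpq) hp0.le) r)

/-! ### §3. `E_{p_c}|B_int(0,r)| ≤ C r^γ`; `≤ C r` under the triangle condition / in high dimensions -/

/-- `(1 − 1/(2r))^{-r} ≤ 2`, i.e. `1 ≤ 2 (1 − 1/(2r))^r` (`r ≥ 1`; Bernoulli). [folklore] -/
theorem one_le_two_mul_pow (r : ℕ) (hr : 1 ≤ r) : (1 : ℝ) ≤ 2 * (1 - 1 / (2 * r)) ^ r := by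
  have hr1 : (1 : ℝ) ≤ r := by exact_mod_cast hr
  have h := one_add_mul_le_pow (show (-2 : ℝ) ≤ -(1 / (2 * r)) by
    have h1 : 0 < 1 / (2 * (r : ℝ)) := by positivity
    have h2 : 1 / (2 * (r : ℝ)) ≤ 1 / 2 := by
      rw [div_le_div_iff₀ (by positivity) (by norm_num)]; linarith
    linarith) r
  have heq : (1 : ℝ) + r * -(1 / (2 * r)) = 1 / 2 := by field_simp; ring
  rw [heq, ← sub_eq_add_neg] at h
  linarith

/-- **DICTIONARY, every `d ≥ 2`: a susceptibility envelope `χ(p) ≤ A (p_c − p)^{−γ}` (`0 < p < p_c`) gives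
`E_{p_c}|B_int(0,r)| ≤ 2A(2/p_c)^γ · r^γ` for all `r ≥ 1`** (take `p = p_c(1 − 1/(2r))`; `γ` real, in practice `γ ≥ 0`): the
intrinsic volume growth exponent at criticality is at most `γ`. [cite: HeydenreichVanDerHofstad2017, Lemma 11.6 (proof, with γ general)] -/
theorem sumBall_criticalProbI_le_rpow_of_chi_le (hd : 2 ≤ d) {A γ : ℝ}
    (hχ : ∀ p : unitInterval, 0 < (p : ℝ) → (p : ℝ) < criticalProb (zdGraph d) (0 : Site d) →
      chi d p ≤ A * (criticalProb (zdGraph d) 0 - p) ^ (-γ)) (r : ℕ) (hr : 1 ≤ r) :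
    SB[criticalProbI d, r] ≤ 2 * A * (2 / criticalProbI d) ^ γ * (r : ℝ) ^ γ := by
  have hd1 : 1 ≤ d := by omega
  set pc : ℝ := (criticalProbI d : ℝ) with hpc
  have hpc0 : 0 < pc := by rw [hpc, coe_criticalProbI]; exact criticalProb_zd_pos d hd1
  have hpc1 : pc < 1 := by rw [hpc, coe_criticalProbI]; exact criticalProb_zd_lt_one hd
  have hr0 : (0 : ℝ) < r := by exact_mod_cast hr
  have hr1 : (1 : ℝ) ≤ r := by exact_mod_cast hr
  -- the comparison parameter `p = p_c (1 - 1/(2r))`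
  set pr : ℝ := pc * (1 - 1 / (2 * r)) with hpr
  have hinv0 : 0 < 1 / (2 * (r : ℝ)) := by positivity
  have hinv1 : 1 / (2 * (r : ℝ)) ≤ 1 / 2 := by rw [div_le_div_iff₀ (by positivity) (by norm_num)]; linarith
  have hfac0 : 0 < 1 - 1 / (2 * (r : ℝ)) := by linarith
  have hfac1 : 1 - 1 / (2 * (r : ℝ)) < 1 := by linarith
  have hpr0 : 0 < pr := mul_pos hpc0 hfac0
  have hprlt : pr < pc := by rw [hpr]; nlinarith
  let p : unitInterval := ⟨pr, hpr0.le, (hprlt.trans hpc1).le⟩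
  have hpv : (p : ℝ) = pr := rfl
  have hgap : criticalProb (zdGraph d) 0 - (p : ℝ) = pc / (2 * r) := by
    rw [← coe_criticalProbI, ← hpc, hpv, hpr]; field_simp; ring
  have hS := sumBall_criticalProbI_le hd r p hpr0 (by rw [hpv, ← coe_criticalProbI]; exact hprlt)
  have hχp := hχ p hpr0 (by rw [hpv, ← coe_criticalProbI]; exact hprlt)
  rw [hgap] at hχp
  -- `(p_c/p)^r = (1 - 1/(2r))^{-r} ≤ 2`
  have hratio : (pc / pr) ^ r ≤ 2 := by
    have h1 : pc / pr = 1 / (1 - 1 / (2 * r)) := by rw [hpr]; field_simp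
    rw [h1, one_div, inv_pow, inv_le_comm₀ (pow_pos hfac0 r) (by norm_num : (0:ℝ) < 2)]
    have := one_le_two_mul_pow r hr
    rw [inv_eq_one_div, div_le_iff₀ (by norm_num : (0:ℝ) < 2)]; linarith
  -- `(p_c/(2r))^{-γ} = (2/p_c)^γ r^γ`
  have hpow : (pc / (2 * r)) ^ (-γ) = (2 / pc) ^ γ * (r : ℝ) ^ γ := by
    rw [Real.rpow_neg (by positivity), ← Real.inv_rpow (by positivity), inv_div,
      show 2 * (r : ℝ) / pc = 2 / pc * r by ring, Real.mul_rpow (by positivity) hr0.le]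
  have hA : 0 ≤ A * (pc / (2 * r)) ^ (-γ) := by
    have h0 : (0 : ℝ) ≤ chi d p := tsum_nonneg fun x => tau_nonneg p 0 x
    exact h0.trans hχp
  calc SB[criticalProbI d, r] ≤ (pc / pr) ^ r * chi d p := hS
    _ ≤ 2 * (A * (pc / (2 * r)) ^ (-γ)) :=
        mul_le_mul hratio hχp (tsum_nonneg fun x => tau_nonneg p 0 x) (by norm_num)
    _ = 2 * A * (2 / criticalProbI d) ^ γ * (r : ℝ) ^ γ := by rw [hpow, hpc]; ring

/-- **KOZMA–NACHMIAS Thm 1.2(i) (upper half) / HvdH Lemma 11.6 under the triangle condition: `E_{p_c}|B_int(0,r)| ≤ C r`** for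
all `r ≥ 1` (Sapozhnikov's proof with `γ = 1`, tree `chi_le_div_of_triangle`).
[cite: KozmaNachmias2009, §1.3 Thm. 1.2(i)] [cite: HeydenreichVanDerHofstad2017, Lemma 11.6 (11.3.4), upper bound] -/
theorem sumBall_criticalProbI_le_linear_of_triangle (hd : 2 ≤ d) (hT : TriangleCondition d) :
    ∃ C : ℝ, 0 < C ∧ ∀ r : ℕ, 1 ≤ r → SB[criticalProbI d, r] ≤ C * r := by
  obtain ⟨A, hA, hχ⟩ := chi_le_div_of_triangle hd hT
  have hpc0 : 0 < (criticalProbI d : ℝ) := by rw [coe_criticalProbI]; exact criticalProb_zd_pos d (by omega)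
  refine ⟨2 * A * (2 / criticalProbI d), by positivity, fun r hr => ?_⟩
  have h := sumBall_criticalProbI_le_rpow_of_chi_le hd (A := A) (γ := 1) (fun p hp0 hp => by
    rw [Real.rpow_neg (by linarith), Real.rpow_one, ← div_eq_mul_inv]; exact hχ p hp) r hr
  simpa only [Real.rpow_one] using h

/-- **HIGH DIMENSIONS, unconditionally: `∃ D > 6, ∀ d ≥ D, ∃ C, ∀ r ≥ 1, E_{p_c}|B_int(0,r)| ≤ C r`** (the triangle condition for
`d ≥ D` is the tree's `HaraSlade1990_triangleCondition_holds`; standard axioms).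
[cite: KozmaNachmias2009, §1.3 Thm. 1.2(i)] [cite: HeydenreichVanDerHofstad2017, Lemma 11.6 (11.3.4)] -/
theorem sumBall_criticalProbI_le_linear_high_dim :
    ∃ D : ℕ, 6 < D ∧ ∀ d : ℕ, D ≤ d → ∃ C : ℝ, 0 < C ∧ ∀ r : ℕ, 1 ≤ r →
      ∑ z ∈ box d r, (bondPercolation (zdGraph d) (criticalProbI d)).real
        {ω : BondConfig (Site d) | z ∈ ball (zdGraph d) 0 r ω} ≤ C * r := by
  obtain ⟨D, hD, hT⟩ := Literature.Barriers.CriticalPhenomena.HaraSlade1990_triangleCondition_holds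
  exact ⟨D, hD, fun d hd => sumBall_criticalProbI_le_linear_of_triangle (by omega) (hT d hd)⟩

end ChemRad

end Summit.CriticalPhenomena.PercolationContinuityZ3.Theorems

end
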